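import Summits.ResolutionOfSingularities.ResolutionOfSingularities.Theorems.HilbertSamuelEliminationSigmaMaxModificationsCorridor3SigmaBoundaryBPermissible
import Literature.AlgebraicGeometry.Resolution.BlowupStalkBlowupAlgebra
import Literature.AlgebraicGeometry.Resolution.BlowupChartModule
import Literature.AlgebraicGeometry.Resolution.BlowupDisjointCentreSplitting
import Literature.AlgebraicGeometry.Resolution.MonomialOrderReductionUnit
import Literature.AlgebraicGeometry.Resolution.NonPrincipalLocus
import Literature.AlgebraicGeometry.Resolution.KollarOrderReduction
import Literature.AlgebraicGeometry.Resolution.MarkedIdealsLemmas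
import HarnessLib

/-!
# [OURS · L1 W4.2] σ-LAYER — `MembersLocallyPrincipal` PROPAGATES: the principal strict transform of a locally principal member is locally principal
# (no hypothesis on the centre), hence under coincidence every member of `E.next C` is locally principal
# (cell res-hironaka, LADDER-RESOLUTION rung L; slot W4.2, crux chain w42 `SigmaMaxModificationsCorridor3` stmt-ResolutionOfSingularities-19249;
# `--supports stmt-ResolutionOfSingularities-19249 --as helper`; the «CA lemma not proved here» of res-L1-type-o1's `Sigma.MembersLocallyPrincipal`
# (`…Corridor3SigmaBoundaryBPermissible` p552583 §4); hand res-D-pv-060 (gen 8), companion of (D1′) `…SigmaBoundaryOffMemberCoincidence` p554842)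

OURS bookkeeping, 0 `def`s, every declaration PROVED; NOT a statement of Hironaka's manuscript [Hironaka2017] nor of [CossartJannsenSaito2020]. AI-written,
weaker than expert review.

* `blowupAlgebra.span_setOf_mul_eq_eq_span_divPow` — THE CHART COMPUTATION «`π^* b = e · b'`»: on `A[𝔭/g]`, for `f ∈ 𝔭`, the ideal of the
  quotients `{u : u·g = r·f}` is principal, generated by `f/g` (`g` is a non-zero-divisor of `A[𝔭/g]`, Stacks 07Z3 (1)).
* `isPrincipal_stalkIdeal_controlledTransform_one` — for `B` with principal stalk `B_x = (f) ⊆ C_x` the stalk at every `x'` over `x` of the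
  controlled transform `(π^*B : 𝓘_E)` is principal (tree dictionary `IsBlowup.stalkIdeal_controlledTransform_eq_map_of_isLocalization`).
* **`isLocallyPrincipal_principalStrictTransform`** — `B` locally principal ⇒ `principalStrictTransform (blowup.π C) C B` locally principal, for ANY
  centre `C` on a locally Noetherian `W` (off the member it is `π^*B`, tree `IsLocallyPrincipal.comap`; on the member it is `(π^*B : 𝓘_E)`).
* **`Boundary.Coincides.isLocallyPrincipal_of_mem_next`** — under coincidence (`E.next C = completeTransformList`, p547994) every member of
  `E.next C` is locally principal if every member of `E` is (the exceptional one by `isLocallyPrincipal_comap_centre`): the run-invariant step for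
  `MembersLocallyPrincipal`.

References: CJS LNM 2270 Def. 5.1, Def. 5.5, (5.2)–(5.3) [CossartJannsenSaito2020]; Stacks 0804, 07Z3 [StacksProject]; Görtz–Wedhorn I (13.19)
[GortzWedhorn2020].
-/

noncomputable section

set_option linter.dupNamespace false

open CategoryTheory AlgebraicGeometry TopologicalSpace IsLocalRing
open Summit.ResolutionOfSingularities.ResolutionOfSingularities.Theorems.CampaignW42
open Literature.AlgebraicGeometry.Resolution Literature.RingTheory.HilbertSamuel

universe u

namespace Literature.AlgebraicGeometry.Resolution

/-! ## §1. The chart computation -/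

section Chart

variable {A : Type u} [CommRing A] {𝔭 : Ideal A} {g f : A}

/-- **`{u ∈ A[𝔭/g] : u·g ∈ f·A} = (f/g)`** for `f ∈ 𝔭`: if `u·g = r·f` then `u = r·(f/g)` since `g` is a non-zero-divisor of `A[𝔭/g]`; and
`(f/g)·g = f`. [cite: StacksProject, Tag 07Z3] [cite: CossartJannsenSaito2020, Def. 5.5, (5.3)] -/
theorem blowupAlgebra.span_setOf_mul_eq_eq_span_divPow (hf : f ∈ 𝔭) (K : Ideal A) (hK : K = Ideal.span {f}) :
    Ideal.span {u : blowupAlgebra 𝔭 g | ∃ k ∈ K,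
        u * algebraMap A (blowupAlgebra 𝔭 g) g ^ 1 = algebraMap A (blowupAlgebra 𝔭 g) k} =
      Ideal.span {blowupAlgebra.divPow 𝔭 g (n := 1) (by rw [pow_one]; exact hf)} := by
  set w : blowupAlgebra 𝔭 g := blowupAlgebra.divPow 𝔭 g (n := 1) (by rw [pow_one]; exact hf) with hwdef
  have hwg : w * algebraMap A (blowupAlgebra 𝔭 g) g = algebraMap A (blowupAlgebra 𝔭 g) f := by
    refine Subtype.ext ?_
    rw [Subalgebra.coe_mul, Subalgebra.coe_algebraMap, Subalgebra.coe_algebraMap, hwdef, blowupAlgebra.coe_divPow, pow_one]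
    exact div_mul_algebraMap g f
  apply le_antisymm
  · rw [Ideal.span_le]
    rintro u ⟨k, hk, hu⟩
    rw [hK] at hk
    obtain ⟨r, rfl⟩ := Ideal.mem_span_singleton'.mp hk
    rw [pow_one, map_mul, ← hwg, ← mul_assoc] at hu
    have hreg := algebraMap_mem_nonZeroDivisors_blowupAlgebra (I := 𝔭) (a := g)
    have : u = algebraMap A (blowupAlgebra 𝔭 g) r * w := (mul_cancel_right_mem_nonZeroDivisors hreg).mp hu
    rw [SetLike.mem_coe, this]
    exact Ideal.mul_mem_left _ _ (Ideal.mem_span_singleton_self w)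
  · rw [Ideal.span_singleton_le_iff_mem]
    refine Ideal.subset_span ⟨f, by rw [hK]; exact Ideal.mem_span_singleton_self f, ?_⟩
    rw [pow_one, hwg]

end Chart

/-! ## §2. Stalks of `(π^*B : 𝓘_E)` for a principal `B_x ⊆ C_x` -/

section Stalk

variable {W W' : Scheme.{u}} [IsLocallyNoetherian W] [IsLocallyNoetherian W'] {π : W' ⟶ W} {C : W.IdealSheafData}

/-- **`(π^*B : 𝓘_E)_{x'}` is principal** when `B_{π x'} = (f)` with `f ∈ C_{π x'}`: it is generated by the image of `f/c_j` from the chart algebra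
`𝒪_{W,x}[C_x/c_j]` presenting `𝒪_{W',x'}`. [cite: CossartJannsenSaito2020, Def. 5.5, (5.3)] [cite: StacksProject, Tag 0804] -/
theorem IsBlowup.isPrincipal_stalkIdeal_controlledTransform_one (hπ : IsBlowup π C) (B : W.IdealSheafData) (x' : W')
    (hB : (stalkIdeal B (π x')).IsPrincipal) (hle : stalkIdeal B (π x') ≤ stalkIdeal C (π x')) :
    (stalkIdeal (controlledTransform π C B 1) x').IsPrincipal := by
  by_cases hx : π x' ∈ C.support
  swap
  · rw [stalkIdeal_controlledTransform_of_not_mem_support B 1 hx]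
    obtain ⟨f, hf⟩ := hB
    refine ⟨(π.stalkMap x').hom f, ?_⟩
    change (stalkIdeal B (π x')).map _ = Ideal.span {(π.stalkMap x').hom f}
    rw [show stalkIdeal B (π x') = Ideal.span {f} from hf, Ideal.map_span, Set.image_singleton]
  obtain ⟨f, hf⟩ := hB
  have hBx : stalkIdeal B (π x') = Ideal.span {f} := hf
  obtain ⟨k, c, hc⟩ := (Submodule.fg_iff_exists_fin_generating_family).mp (IsNoetherian.noetherian (stalkIdeal C (π x')))
  have hc' : Ideal.span (Set.range c) = stalkIdeal C (π x') := hc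
  obtain ⟨j, 𝔔, χ, e, hχ, hloc, -, -⟩ := hπ.exists_blowupAlgebra_stalk_ringEquiv x' c hc'
  obtain ⟨-, hK⟩ := hπ.stalkIdeal_controlledTransform_eq_map_of_isLocalization x' c hc' j 𝔔 χ hχ hloc
  have hfC : f ∈ Ideal.span (Set.range c) := by
    rw [hc']; exact hle (hBx ▸ Ideal.mem_span_singleton_self f)
  have hBle : stalkIdeal B (π x') ≤ Ideal.span (Set.range c) ^ 1 := by
    rw [pow_one, hc']; exact hle
  rw [hK B 1 hBle, blowupAlgebra.span_setOf_mul_eq_eq_span_divPow hfC _ hBx, Ideal.map_span, Set.image_singleton]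
  exact ⟨⟨_, rfl⟩⟩

end Stalk

/-! ## §3. The principal strict transform of a locally principal member -/

section Sheaf

variable {W : Scheme.{u}} [IsLocallyNoetherian W]

/-- [OURS · L1 W4.2] **The principal strict transform of a LOCALLY PRINCIPAL member is locally principal** — for any centre `C` on a locally
Noetherian `W`: off the member (`¬ B ≤ C`) it is the total transform `π^*B`, on the member (`B ≤ C`) it is `(π^*B : 𝓘_E)` whose stalks are
the principal ideals `(f/c_j)`. [cite: CossartJannsenSaito2020, Def. 5.1, Def. 5.5, (5.2)–(5.3)] -/
theorem isLocallyPrincipal_principalStrictTransform (C B : W.IdealSheafData) (hB : IsLocallyPrincipal B) :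
    IsLocallyPrincipal (principalStrictTransform (blowup.π C) C B) := by
  haveI : IsLocallyNoetherian (blowup C) := (blowup.isBlowup C).isLocallyNoetherian
  by_cases hle : B ≤ C
  · rw [principalStrictTransform_of_le hle]
    intro x'
    rw [isLocallyPrincipalAt_iff_isPrincipal_stalkIdeal]
    exact (blowup.isBlowup C).isPrincipal_stalkIdeal_controlledTransform_one B x' ((hB _).isPrincipal_stalkIdeal)
      (stalkIdeal_mono hle _)
  · rw [principalStrictTransform_of_not_le hle]
    exact hB.comap _

end Sheaf

end Literature.AlgebraicGeometry.Resolution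

/-! ## §4. The run-invariant step -/

namespace Summit.ResolutionOfSingularities.ResolutionOfSingularities.Theorems.SigmaMaxModificationsCorridor3.Sigma

variable {W : Scheme.{u}} [IsLocallyNoetherian W]

/-- Every member of CJS's complete transform `{B₁', …, Bₙ', E}` of a boundary of locally principal members is locally principal. [cite:
CossartJannsenSaito2020, Def. 5.7] -/
theorem isLocallyPrincipal_of_mem_completeTransformList {E : Boundary W} (C : W.IdealSheafData) (hE : ∀ B ∈ E, IsLocallyPrincipal B)
    {B' : (blowup C).IdealSheafData} (hB' : B' ∈ completeTransformList (blowup.π C) C E) : IsLocallyPrincipal B' := by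
  haveI : IsLocallyNoetherian (blowup C) := (blowup.isBlowup C).isLocallyNoetherian
  rw [completeTransformList, List.mem_append, List.mem_map, List.mem_singleton] at hB'
  rcases hB' with ⟨B, hB, rfl⟩ | rfl
  · exact isLocallyPrincipal_principalStrictTransform C B (hE B hB)
  · exact isLocallyPrincipal_comap_centre C

/-- [OURS · L1 W4.2] **`MembersLocallyPrincipal` PROPAGATES along a coinciding step**: if every member of `E` is locally principal and `E` coincides
under the blow-up of `C`, every member of `E.next C` is locally principal. (The step behind res-L1-type-o1's scope property
`Sigma.MembersLocallyPrincipal`, p552583.) [cite: CossartJannsenSaito2020, Def. 5.1, Def. 5.7] -/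
theorem Boundary.Coincides.isLocallyPrincipal_of_mem_next {E : Boundary W} {C : W.IdealSheafData} (h : E.Coincides C)
    (hE : ∀ B ∈ E, IsLocallyPrincipal B) : ∀ B' ∈ E.next C, IsLocallyPrincipal B' := by
  intro B' hB'
  rw [Boundary.next_eq_completeTransformList_of_coincides h] at hB'
  exact isLocallyPrincipal_of_mem_completeTransformList C hE hB'

end Summit.ResolutionOfSingularities.ResolutionOfSingularities.Theorems.SigmaMaxModificationsCorridor3.Sigma

end
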